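import Literature.Barriers.BirchSwinnertonDyer.TraceZeroHeegnerTowerAtAdditiveSplitP
import Summits.BirchSwinnertonDyer.BirchSwinnertonDyer.Theorems.UniversalToricDescentThinCombDefs

/-!
# Crux idea `unramified-regulator` (seat bsd-wall-utd-idea g48) — typed sketch for
`UniversalToricDescent.AdditiveSplitIMCInclusionAtThree` (stmt-BirchSwinnertonDyer-20395), line `thin_comb` v5,
stub `stub_combDivisibility` (K2 / K2⁺), sub-item K2(b) «𝛉-dominant explicit reciprocity law on each comb line».

THE LEVER. On the tooth of level `m` (the translate of the `𝔭`-axis by a finite cyclotomic character `ε_m`,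
`ε_m(γ_𝔭') = ζ_{3^{m+1}}`), the Beilinson–Flach classes of the `𝔭`-branch CM family vary `Λ`-adically ONLY in the
direction `Γ_𝔭 = Gal(K_{𝔭^∞}/K)`, which is UNRAMIFIED at the regulator prime `𝔭'` (the prime carrying the
unramified quotient `F⁻𝐠 = ψ|_{D_𝔭'}` on which the `𝛉`-dominant law is read, pairing `ω_f ⊗ η_𝛉`). Locally at
`𝔭'` the tooth's tower is `L_m·F_∞` with `F_∞/ℚ₃` the unramified `ℤ₃`-extension and `L_m/ℚ₃` ONE fixed totally
ramified layer. For `E` ADDITIVE at `3` the formal group is `Ĝ_a`-integral (tree: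
`Rank1Residual.Additive.norm_coeff_formalLog_baseChange_le_one_of_addv`, `…formalExp…`), so
`log : Ê(𝔪) ⥲ 𝔪` integrally, `𝔪_{F_n} = 3𝒪_{F_n}`, and `LOG := ⅓·log(3·)` identifies `E₀(F_n) ⊗ ℤ₃` with
`𝒪_{F_n} ≅ ℤ₃[Gal(F_n/ℚ₃)]` up to the bounded group `E₀(F_n)[3]` (§2 below: NO CONDUCTOR IS LOST at an unramified
`Ĝ_a`-type prime — contrast `B-g39-3`, which is about the totally ramified tower). Norms `F_{n+1} → F_n` are ONTO
on `𝒪`, so the local points form a NORM-ONTO tower (§1: the positive mirror of the catalogued barrier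
`TraceZeroHeegnerTowerAtAdditiveSplitP`, whose Heegner tower is trace-ZERO): `H¹_{f,Iw}(L_m F_∞, T₃E)^{(ε_m)}` is
`Λ_U[ζ]`-free of rank one up to exponent `t_m = O(m) + c(E)` and the `𝛉`-dominant Coleman map of the tooth is the
`Λ_U`-adic formal-group logarithm — an elementary INTEGRAL injection with cokernel exponent `≤ t_m`; no
Perrin-Riou / Wach-module / triangulation input and no crystalline hypothesis on `V_f` is needed (K2(b-loc)).
What remains of K2(b) is the VALUE identity at the geometric CM points of weight `≥ 2` of each tooth (K2(b-val),
cards `stable-fibre-regulator` T2/T3, `fern-reciprocity`), and the per-tooth slack `3^{t_m}` is exactly what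
`ThinCombDvdRat` (`∃ t` per level) tolerates.

Contents: §1 norm-onto towers in the barrier's own currency (`towerLayer`, `towerNorm`): every bottom point extends
to a norm-compatible family (vs. (ii) of the barrier: only `0` is norm-compatible over a trace-zero family);
§2 the `LOG`-extension lemma («division by `p` without conductor loss»): for `B ≤ A` with `p•A ≤ B` and an
injective `ℓ : B → O` onto `p•O` (`O` without `p`-torsion) there is a unique additive `Λ : A → O` with
`p•Λ a = ℓ(p•a)`; it extends `ℓ`, `ker Λ = A[p]`, and `Λ a ∈ p•O ↔ a ∈ B + A[p]` — so `Λ` embeds `A/(B + A[p])`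
into `O/p•O` (reading: `A = E₀(F_n L_m)⊗ℤ₃`, `B = Ê(𝔪)`, `ℓ = log_Ê`, `O = ⅓𝔪`, `p = 3`).
Everything is sorry-free; no new axioms. References: [KLZ17] = arXiv:1503.02888 Thm 8.2.3 / Thm 10.2.2 (the
printed regulator needs an UNRAMIFIED profinite module); [LLZ15] = arXiv:1311.0175 Thm 6.4.1 (split case: `log_p`
paired with `ω_f ⊗ η_{g_ψ}`, `f` not assumed ordinary); [Wan, arXiv:1607.07729 p. 7]; Honda 1970 Thm 2;
Silverman AEC VII.5; tree barrier file `TraceZeroHeegnerTowerAtAdditiveSplitP`.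
-/

-- single-conjunct summit: the namespace repeats `BirchSwinnertonDyer` by design
set_option linter.dupNamespace false

namespace Summit.BirchSwinnertonDyer.BirchSwinnertonDyer.Cruxes.AdditiveSplitIMCInclusionAtThree.UnramifiedRegulator

/-! ## §1 Norm-onto towers (the unramified local tower) vs. trace-zero families (the Heegner tower) -/

section NormOnto

open Literature.Barriers.BirchSwinnertonDyer.TraceZeroTower

universe u v

variable {R : Type u} [CommRing R] {H : Type v} [AddCommGroup H] [Module R H]

/-- **Norm-onto tower**: every point of layer `m` is the relative norm `N_{m+1,m}` of a point of layer `m+1`.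
Reading: `H = lim→ (E₀(F_n L) ⊗ ℤ₃) ≅ lim→ 𝒪_{F_n L}`-lattices for the UNRAMIFIED `ℤ₃`-tower `F_∞/ℚ₃`
(`Tr_{F_{n+1}/F_n} 𝒪_{F_{n+1}} = 𝒪_{F_n}`), `γ` = Frobenius. -/
def IsNormOntoTower (γ : Module.End R H) (p : ℕ) : Prop :=
  ∀ m : ℕ, ∀ x ∈ towerLayer γ p m, ∃ y ∈ towerLayer γ p (m + 1), towerNorm γ p m y = x

/-- A **norm-compatible family** through the tower: `z_m ∈` layer `m` and `N_{m+1,m} z_{m+1} = z_m`. -/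
def IsNormCompatible (γ : Module.End R H) (p : ℕ) (z : ℕ → H) : Prop :=
  (∀ m : ℕ, z m ∈ towerLayer γ p m) ∧ ∀ m : ℕ, towerNorm γ p m (z (m + 1)) = z m

/-- The recursive lift of a bottom point through a norm-onto tower (auxiliary, by choice). -/
private noncomputable def liftSeq {γ : Module.End R H} {p : ℕ} (h : IsNormOntoTower γ p) (x : H)
    (hx : x ∈ towerLayer γ p 0) : (m : ℕ) → {y : H // y ∈ towerLayer γ p m}
  | 0 => ⟨x, hx⟩
  | m + 1 =>
    ⟨Classical.choose (h m (liftSeq h x hx m).1 (liftSeq h x hx m).2),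
      (Classical.choose_spec (h m (liftSeq h x hx m).1 (liftSeq h x hx m).2)).1⟩

/-- **Positive mirror of the barrier.** In a norm-onto tower EVERY bottom point `x` is the foot of a norm-compatible
family `(z_m)_m`, `z_0 = x` — whereas over a trace-zero family (the Heegner tower at an additive split prime,
`Literature.Barriers.BirchSwinnertonDyer.TraceZeroHeegnerTowerAtAdditiveSplitP` (ii)) the only norm-compatible
family of layer combinations is `0`. This is the module-theoretic reason the tooth's local condition at the
UNRAMIFIED prime is `Λ`-adic (a Coleman map exists) while no `κ_∞` exists in the anticyclotomic tower. -/
theorem exists_normCompatible_of_isNormOntoTower {γ : Module.End R H} {p : ℕ} (h : IsNormOntoTower γ p)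
    {x : H} (hx : x ∈ towerLayer γ p 0) :
    ∃ z : ℕ → H, z 0 = x ∧ IsNormCompatible γ p z := by
  refine ⟨fun m => (liftSeq h x hx m).1, rfl, fun m => (liftSeq h x hx m).2, fun m => ?_⟩
  show towerNorm γ p m (liftSeq h x hx (m + 1)).1 = (liftSeq h x hx m).1
  rw [liftSeq]
  exact (Classical.choose_spec (h m (liftSeq h x hx m).1 (liftSeq h x hx m).2)).2

/-- In a norm-onto tower every layer-`m` point is a norm from every higher layer `n ≥ m` (iterated norms are onto):
there is `y ∈` layer `n` with `N_{m+1,m} ∘ ⋯ ∘ N_{n,n-1} (y) = x`. Stated with the composite as a function. -/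
theorem exists_iterate_norm_eq_of_isNormOntoTower {γ : Module.End R H} {p : ℕ} (h : IsNormOntoTower γ p)
    (m k : ℕ) {x : H} (hx : x ∈ towerLayer γ p m) :
    ∃ y ∈ towerLayer γ p (m + k),
      (Nat.rec (motive := fun _ => H → H) id (fun j f => fun v => f (towerNorm γ p (m + j) v)) k) y = x := by
  induction k with
  | zero => exact ⟨x, hx, rfl⟩
  | succ k ih =>
    obtain ⟨y, hy, hyx⟩ := ih
    obtain ⟨y', hy', hy'y⟩ := h (m + k) y hy
    refine ⟨y', hy', ?_⟩
    show (Nat.rec (motive := fun _ => H → H) id (fun j f => fun v => f (towerNorm γ p (m + j) v)) k)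
      (towerNorm γ p (m + k) y') = x
    rw [hy'y]
    exact hyx

/-- **Trace-zero and norm-onto are incompatible on a line**: if `y` is a trace-zero family whose member `y (m+1)`
is ALSO a norm-preimage of `y m` (as a norm-onto tower would provide inside the span of the family), then
`y m = 0`. (One-line bookkeeping making the contrast explicit.) -/
theorem eq_zero_of_traceZero_of_norm_eq {γ : Module.End R H} {p : ℕ} {y : ℕ → H}
    (h : IsTraceZeroFamily γ p y) (m : ℕ) (hn : towerNorm γ p m (y (m + 1)) = y m) : y m = 0 := by
  rw [← hn]
  exact h.2 m

end NormOnto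

/-! ## §2 The `LOG`-extension lemma: dividing the formal logarithm by `p` on `E₀ ⊇ Ê(𝔪)` loses no conductor -/

section LogExtension

variable {A O : Type*} [AddCommGroup A] [AddCommGroup O]

/-- Multiplication by `p` as an additive map `A →+ B` when `p • A ≤ B` (reading: `E₀(F) → Ê(𝔪_F) = E₁(F)`,
`E₀/E₁ ≅ k_F⁺` is killed by `p`). -/
def mulInto (B : AddSubgroup A) (p : ℕ) (hB : ∀ a : A, p • a ∈ B) : A →+ B where
  toFun a := ⟨p • a, hB a⟩
  map_zero' := by ext; simp
  map_add' a b := by ext; simp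

@[simp] theorem coe_mulInto (B : AddSubgroup A) (p : ℕ) (hB : ∀ a : A, p • a ∈ B) (a : A) :
    ((mulInto B p hB a : B) : A) = p • a := rfl

/-- Hypotheses of the lemma, bundled: `p•A ≤ B`; `ℓ : B →+ O` injective with image exactly `p•O`; `O` has no
`p`-torsion. Reading (unramified layer `F = F_n`, additive `E/ℚ₃`, `p = 3`): `A = E₀(F) ⊗ ℤ₃`, `B = Ê(𝔪_F)`,
`O = 𝒪_F`, `ℓ = log_Ê` with `log_Ê(Ê(3𝒪_F)) = 3𝒪_F` because `log_Ê, exp_Ê ∈ ℤ₃⟦X⟧` (tree, Honda type `p`) and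
`𝔪_F = 3𝒪_F` (unramified). -/
structure LogData (B : AddSubgroup A) (p : ℕ) (ℓ : B →+ O) : Prop where
  mul_mem : ∀ a : A, p • a ∈ B
  inj : Function.Injective ℓ
  image_sub : ∀ b : B, ∃ y : O, ℓ b = p • y
  image_sup : ∀ y : O, ∃ b : B, ℓ b = p • y
  noTorsion : ∀ y : O, p • y = 0 → y = 0

namespace LogData

variable {B : AddSubgroup A} {p : ℕ} {ℓ : B →+ O}

/-- `LOG a :=` the unique `y` with `p • y = ℓ (p • a)` (i.e. `⅓·log(3a)`), as a bare function. -/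
noncomputable def logFun (h : LogData B p ℓ) (a : A) : O :=
  Classical.choose (h.image_sub (mulInto B p h.mul_mem a))

theorem p_smul_logFun (h : LogData B p ℓ) (a : A) :
    p • h.logFun a = ℓ (mulInto B p h.mul_mem a) :=
  (Classical.choose_spec (h.image_sub (mulInto B p h.mul_mem a))).symm

/-- Cancellation of `p` in `O`. -/
theorem smul_cancel (h : LogData B p ℓ) {y y' : O} (hyy : p • y = p • y') : y = y' := by
  have : p • (y - y') = 0 := by rw [nsmul_sub, hyy, sub_self]
  exact sub_eq_zero.mp (h.noTorsion _ this)

/-- **`LOG` is additive**: the extension `LOG : A →+ O`. -/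
noncomputable def LOG (h : LogData B p ℓ) : A →+ O where
  toFun := h.logFun
  map_zero' := by
    apply h.smul_cancel
    rw [p_smul_logFun, map_zero, map_zero, nsmul_zero]
  map_add' a b := by
    apply h.smul_cancel
    rw [p_smul_logFun, map_add, map_add, nsmul_add, p_smul_logFun, p_smul_logFun]

theorem LOG_apply (h : LogData B p ℓ) (a : A) : h.LOG a = h.logFun a := rfl

/-- Defining identity: `p • LOG a = ℓ (p • a)`. -/
theorem p_smul_LOG (h : LogData B p ℓ) (a : A) : p • h.LOG a = ℓ (mulInto B p h.mul_mem a) :=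
  h.p_smul_logFun a

/-- **`LOG` extends `ℓ`** on `B` (`LOG|_{E₁} = log_Ê`). -/
theorem LOG_coe (h : LogData B p ℓ) (b : B) : h.LOG (b : A) = ℓ b := by
  apply h.smul_cancel
  rw [p_smul_LOG, ← map_nsmul]
  congr 1

/-- **Uniqueness**: any additive `Λ` with `p • Λ a = ℓ (p • a)` is `LOG`. -/
theorem eq_LOG_of_p_smul_eq (h : LogData B p ℓ) (Λ : A →+ O)
    (hΛ : ∀ a : A, p • Λ a = ℓ (mulInto B p h.mul_mem a)) : Λ = h.LOG := by
  ext a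
  exact h.smul_cancel (by rw [hΛ, p_smul_LOG])

/-- **Kernel = `A[p]`** (`ker LOG = E₀(F)[3]`, a group of order `≤ |E(F_∞)[3]| ≤ 9`): `LOG a = 0 ↔ p • a = 0`. -/
theorem LOG_eq_zero_iff (h : LogData B p ℓ) (a : A) : h.LOG a = 0 ↔ p • a = 0 := by
  constructor
  · intro ha
    have h1 : ℓ (mulInto B p h.mul_mem a) = 0 := by rw [← h.p_smul_LOG, ha, nsmul_zero]
    have h2 : mulInto B p h.mul_mem a = 0 := h.inj (by rw [h1, map_zero])
    have h3 : ((mulInto B p h.mul_mem a : B) : A) = ((0 : B) : A) := congrArg (fun b : B => (b : A)) h2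
    rw [coe_mulInto, AddSubgroup.coe_zero] at h3
    exact h3
  · intro ha
    apply h.smul_cancel
    have h2 : mulInto B p h.mul_mem a = 0 := by
      apply Subtype.ext
      rw [coe_mulInto, AddSubgroup.coe_zero]
      exact ha
    rw [p_smul_LOG, h2, map_zero, nsmul_zero]

/-- **No conductor loss**: `LOG a ∈ p•O ↔ a ∈ B + A[p]`. Hence `LOG` induces an INJECTION
`A ⧸ (B + A[p]) ↪ O ⧸ p•O`; in the reading `|A/B| = |k_F| = |𝒪_F/3𝒪_F|`, so `[𝒪_F : LOG(E₀(F))] = |E₀(F)[3]|`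
is bounded independently of the unramified layer `F = F_n` — the tooth's local points are `𝒪_{F_n}` up to a
bounded error, norm-compatibly in `n`. -/
theorem LOG_mem_iff (h : LogData B p ℓ) (a : A) :
    (∃ y : O, h.LOG a = p • y) ↔ ∃ b : B, ∃ t : A, p • t = 0 ∧ a = (b : A) + t := by
  constructor
  · rintro ⟨y, hy⟩
    obtain ⟨b, hb⟩ := h.image_sup y
    refine ⟨b, a - b, ?_, by abel⟩
    rw [← h.LOG_eq_zero_iff, map_sub, LOG_coe, hb, hy, sub_self]
  · rintro ⟨b, t, ht, rfl⟩
    obtain ⟨y, hy⟩ := h.image_sub b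
    refine ⟨y, ?_⟩
    rw [map_add, LOG_coe, (h.LOG_eq_zero_iff t).mpr ht, add_zero, hy]

/-- If `A` has no `p`-torsion (`E(F_∞)[3] = 0`, e.g. no `3`-torsion defined over `ℚ₃^{ur}`), `LOG` is injective. -/
theorem LOG_injective (h : LogData B p ℓ) (hA : ∀ a : A, p • a = 0 → a = 0) : Function.Injective h.LOG := by
  intro a a' haa
  have : h.LOG (a - a') = 0 := by rw [map_sub, haa, sub_self]
  exact sub_eq_zero.mp (hA _ ((h.LOG_eq_zero_iff _).mp this))

/-- … and then `LOG a ∈ p•O ↔ a ∈ B`: `LOG` identifies `A/B` with a subgroup of `O/p•O` (equality by counting in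
the reading), i.e. `LOG : E₀(F_n) ⊗ ℤ₃ ⥲ 𝒪_{F_n}` is an integral ISOMORPHISM on every unramified layer. -/
theorem LOG_mem_iff_of_noTorsion (h : LogData B p ℓ) (hA : ∀ a : A, p • a = 0 → a = 0) (a : A) :
    (∃ y : O, h.LOG a = p • y) ↔ a ∈ B := by
  rw [h.LOG_mem_iff]
  constructor
  · rintro ⟨b, t, ht, rfl⟩
    rw [hA t ht, add_zero]
    exact b.2
  · intro ha
    exact ⟨⟨a, ha⟩, 0, by simp, by simp⟩

/-- **`LOG` is a map of towers** (functoriality ⇒ norm-compatibility): if `τA : A' →+ A` and `τO : O' →+ O`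
(reading: the traces `E₀(F_{n+1}) → E₀(F_n)`, `𝒪_{F_{n+1}} → 𝒪_{F_n}`) carry `B'` into `B` and intertwine
`ℓ'` with `ℓ` (`log_Ê` is Galois-equivariant and additive, so it commutes with traces), then
`LOG ∘ τA = τO ∘ LOG'`. Hence `LOG_∞ := lim← LOG_n : lim← E₀(F_n) ⊗ ℤ₃ → lim← 𝒪_{F_n} ≅ Λ_U` is defined and
`Λ_U`-linear (apply the lemma also to `τ = γ − 1`-type maps / the Galois action). -/
theorem LOG_comp {A' O' : Type*} [AddCommGroup A'] [AddCommGroup O'] {B' : AddSubgroup A'} {ℓ' : B' →+ O'}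
    (h : LogData B p ℓ) (h' : LogData B' p ℓ') (τA : A' →+ A) (τO : O' →+ O)
    (hτB : ∀ b' : B', τA (b' : A') ∈ B) (hτℓ : ∀ b' : B', ℓ ⟨τA (b' : A'), hτB b'⟩ = τO (ℓ' b')) :
    h.LOG.comp τA = τO.comp h'.LOG := by
  ext a'
  rw [AddMonoidHom.comp_apply, AddMonoidHom.comp_apply]
  apply h.smul_cancel
  have hm : mulInto B p h.mul_mem (τA a') = ⟨τA ((mulInto B' p h'.mul_mem a' : B') : A'), hτB _⟩ := by
    apply Subtype.ext
    show p • τA a' = τA ((mulInto B' p h'.mul_mem a' : B') : A')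
    rw [coe_mulInto, map_nsmul]
  rw [p_smul_LOG, hm, hτℓ, ← map_nsmul, p_smul_LOG]

/-- **Equivariance** (the case `A' = A`, `O' = O`): `LOG` commutes with every pair of compatible endomorphisms —
in the reading, with `Gal(F_n L_m/ℚ₃)`, so `LOG` respects `ε_m`-isotypic parts and the `ℤ₃[Gal(F_n/ℚ₃)]`-structure. -/
theorem LOG_equivariant (h : LogData B p ℓ) (σA : A →+ A) (σO : O →+ O)
    (hσB : ∀ b : B, σA (b : A) ∈ B) (hσℓ : ∀ b : B, ℓ ⟨σA (b : A), hσB b⟩ = σO (ℓ b)) (a : A) :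
    h.LOG (σA a) = σO (h.LOG a) := by
  have := h.LOG_comp h σA σO hσB hσℓ
  exact DFunLike.congr_fun this a

/-- **Integral isomorphism on an unramified layer**: if `A` has no `p`-torsion and the injection
`A/B ↪ O/p•O` induced by `LOG` is onto (in the reading both sides have `|k_{F_n}|` elements:
`E₀(F_n)/E₁(F_n) ≅ k⁺`, `𝒪_{F_n}/3𝒪_{F_n} ≅ k`), then `LOG : A → O` is a BIJECTION — `E₀(F_n) ⊗ ℤ₃ ≅ 𝒪_{F_n}`. -/
theorem LOG_bijective_of_surjective_mod (h : LogData B p ℓ) (hA : ∀ a : A, p • a = 0 → a = 0)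
    (hsurj : ∀ y : O, ∃ a : A, ∃ y' : O, h.LOG a = y + p • y') : Function.Bijective h.LOG := by
  refine ⟨h.LOG_injective hA, fun y => ?_⟩
  obtain ⟨a, y', hay⟩ := hsurj y
  obtain ⟨b, hb⟩ := h.image_sup y'
  refine ⟨a - (b : A), ?_⟩
  rw [map_sub, LOG_coe, hay, hb, add_sub_cancel_right]

end LogData

end LogExtension

/-! ## §3 What the lever hands the line (docstring only; the items are informal until the tree has `H¹_Iw`)

K2 = `stub_combDivisibility` needs, per tooth `m` (pinned frame, `R₀ ⊇ ℤ₃[ζ_{3^{m+1}}]`):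
`const R₀ (3^{t_m}) * L₂ ∈ Ideal.span {G, combElt R₀ 3 m}` (`ThinCombDvdRat`, `∃ t` per level). Supply chain with
the lever in place:
* K2(a)  classes: `𝔭`-branch Beilinson–Flach family for `(f_E ⊗ ε_m, 𝐠^{(𝔭)})` at `p = 3 ∣ N` (KLZ17 §6.3 allows
  `p ∣ N`, Thm 6.3.4; the `c`-factor and `p = 3` as on the card of record) — UNCHANGED;
* K2(b-loc) THIS SKETCH: `LOG_m : H¹_{f,Iw}(tooth, 𝔭') ↪ Λ_U[ζ]`, cokernel exponent `≤ t_m = O(m) + c(E)`,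
  `c(E) ≤ v₃(|E(ℚ₃^{ur})[3^∞]|·|Φ_E[3]|)`; Selmer structure `(relaxed at 𝔭, f at 𝔭')` is cartesian/free at `𝔭'`;
  Poitou–Tate: `char X_{0 at 𝔭, ∅ at 𝔭'}|_{tooth} ∣ 3^{t_m} · LOG_m(loc_{𝔭'} κ_m)` given K2(c);
* K2(b-val) OPEN (research kernel, = cards `stable-fibre-regulator` T2/T3 / `fern-reciprocity`): at the CM points
  `λ·ε_m` of the tooth with `λ` of infinity type `(k,0)`, `k ≥ 1` (ALL geometric, `j = 0`; NO critical point lies on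
  a tooth), `⟨LOG_m(loc κ_m)(λε_m), ω_f ⊗ η_{θ_λ}⟩ = (c-factor)(CM Euler factors) · L₂(λε_m)`; density in `λ` then
  gives the `Λ_U[ζ]`-identity;
* K2(c)  Kolyvagin-system bound at `p = 3` (MR big image; barrier `EulerSystemBigImageAtSmallImage`) — UNCHANGED.
-/

end Summit.BirchSwinnertonDyer.BirchSwinnertonDyer.Cruxes.AdditiveSplitIMCInclusionAtThree.UnramifiedRegulator
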